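import Literature.NumberTheory.DiophantineGeometry.MordellThueRamanujanNagellHeightBounds
import Literature.NumberTheory.EllipticCurves.HeightConductorBoundsModularity
import HarnessLib

/-!
# The optimized height bounds `Ω_opt` of von Känel–Matschke (Prop. 10.7) and the corollaries that use
# them verbatim (Cor. 8.2, (8.x), Cor. 9.1, Cor. 9.3)

Topic `Literature/NumberTheory/DiophantineGeometry` (family `abc`; the *modular method*). Third Diophantine
file of the literature-typing of R. von Känel, B. Matschke, arXiv:1605.06079 (Feb. 2016 version, held TeX
text) = Mem. AMS **286** (2023) no. 1419 [`VonkanelMatschke2023`]; arXiv numbering throughout. It joins the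
Diophantine vocabulary of `SUnitMordellHeightBoundsModularity.lean` / `MordellThueRamanujanNagellHeightBounds.lean`
(`primesProd = N_S`, `IsSInteger`, `IsSUnit`, `mordellLevel = a_S`, `omegaSim = Ω_sim`, `refinedExp/refinedCoeff`,
`cubicFormEval`, `IsSIntegralData`, `IsIntegralData`, `coeffHeight = h(f − m)`) with the quantity
`α = min(β, β*)` and `κ = 4π + log(163/π)` of `Literature/NumberTheory/EllipticCurves/HeightConductorBoundsModularity.lean`
(`vkmAlpha`, `vkmKappa`; vKM §10.5.1), so that the OPTIMIZED bounds can be typed as printed: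

* **Prop. 10.7** (`prop:algobounds`, §10.5.1): *"Proposition 10.6 holds with the bound `(6/5) α(2^𝔢 N_S) + 28`,
  and Proposition 10.1 holds with the bound `(1/3) h(a) + 4 α(a_S) + 2 log(α(a_S) + κ) + 35 + 4κ`."* The second
  bound is the quantity `Ω_opt = Ω_opt(a, S)` of §8.2 and §9 (`omegaOpt`).
* the printed comparison **`Ω_opt ≤ Ω_sim`** (§8.2 and §9, displays before Cor. 8.2 and Cor. 9.1);
* **Cor. 9.1** (`cor:ranabounds`) and **Cor. 9.3** (`cor:sumsofunits`) with `Ω_opt` (the sibling file records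
  the WEAKER `Ω_sim`-forms `corollary_9_1_sim`, `corollary_9_3_sim`; here they are DERIVED from the exact forms
  and `Ω_opt ≤ Ω_sim`);
* **Cor. 8.2** (`cor:precthue`: cubic Thue and GENERAL cubic Thue–Mahler with primitive solutions, Definition
  5.1 `def:primsoltm`) and the display **(8.x) `eq:precthue`** (the bounds `B₁`, `2B₁ + 51 log N_S` without the
  assumption `f, m ∈ ℤ[x, y]`).

Sign convention (checked against §8.1.1): vKM take the discriminant `Δ` of the binary cubic form
`f = a x³ + b x² y + c x y² + d y³` "in the sense of [Salmon]; note the sign convention", and their syzygy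
`(4J)² = (−4𝓗)³ + 432 Δ f²` (with the printed `𝓗`, `J`) holds exactly for `Δ = −Cubic.discr` (the negative of
the modern `b²c² − 4ac³ − 4b³d − 27a²d² + 18abcd`). Every typed bound depends on the parameter `k = 432 Δ m²`
only through `|k|` (`k_S = mordellLevel S k` reads the numerator's absolute value; `h(−k) = h(k)`), so the
rendering `k = 432 · Cubic.discr · m²` used here and in the sibling file is equivalent to print.

NOT here: Prop. 8.1 (`prop:heightineq`, height comparison along the covariant map `φ : X → Y` on `X(ℚ̄)`), the
bars `β̄, β̄*, ᾱ` (10.x) `eq:barbb`. No `abc` claim; typed ≠ proved (named facts `def … : Prop`, D-0014); the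
theorems below are only the printed one-line deductions (`Ω_opt ≤ Ω_sim` ⇒ simplified forms).
-/

noncomputable section

open Height
open Literature.NumberTheory.EllipticCurves.ModularForms (vkmAlpha vkmKappa)

namespace Literature.NumberTheory.DiophantineGeometry

namespace VonKanelMatschke

/-! ### `2^𝔢 N_S`, `Ω_opt`, Prop. 10.7 -/

/-- The level `2^𝔢 N_S ∈ ℕ` of Prop. 10.6/10.7 as a natural number, `𝔢 = 𝔢(ord₂(abc))` from the table
(10.x) `eq:refinedcondbound` (`refinedExp`): `16 N_S`, `4 N_S`, `N_S / 2` (exact: `N_S` is even when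
`ord₂(abc) = 4`), `N_S` for `ord₂(abc) = 1`, `∈ {2,3}`, `= 4`, `≥ 5` respectively.
[cite: VonkanelMatschke2023, §10.4 (eq:refinedcondbound) and Prop. 10.7] -/
def refinedLevel (v N : ℕ) : ℕ :=
  if v = 1 then 16 * N else if v = 2 ∨ v = 3 then 4 * N else if v = 4 then N / 2 else N

/-- **`Ω_opt(a, S) = (1/3) h(a) + 4 α(a_S) + 2 log(α(a_S) + κ) + 35 + 4κ`**, the optimized Mordell bound of
Prop. 10.7 ("`Ω_opt` the optimized height bound provided by Proposition 10.7 with `a = k`", §8.2; §9), with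
`α = min(β, β*)` and `κ = 4π + log(163/π)` of §10.5.1 (`vkmAlpha`, `vkmKappa`).
[cite: VonkanelMatschke2023, Prop. 10.7 (prop:algobounds) and §8.2/§9 (Ω_opt)] -/
def omegaOpt (S : Finset ℕ) (a : ℚ) : ℝ :=
  1 / 3 * logHeight₁ a + 4 * vkmAlpha (mordellLevel S a) + 2 * Real.log (vkmAlpha (mordellLevel S a) + vkmKappa) +
    35 + 4 * vkmKappa

/-- Unfolding lemma for `Ω_opt`. [cite: VonkanelMatschke2023, Prop. 10.7] -/
theorem omegaOpt_def (S : Finset ℕ) (a : ℚ) :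
    omegaOpt S a = 1 / 3 * logHeight₁ a + 4 * vkmAlpha (mordellLevel S a) +
      2 * Real.log (vkmAlpha (mordellLevel S a) + vkmKappa) + 35 + 4 * vkmKappa := rfl

/-- **vKM Prop. 10.7** (`prop:algobounds`): *"Proposition 10.6 holds with the bound `(6/5) α(2^𝔢 N_S) + 28`, and
Proposition 10.1 holds with the bound `(1/3) h(a) + 4 α(a_S) + 2 log(α(a_S) + κ) + 35 + 4κ`."* — i.e. (first
conjunct) every solution of (10.x) `eq:abc` (`a + b = c` in nonzero integers, `gcd(a,b,c) = 1`, `rad(abc) ∣ N_S`)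
has `log max(|a|,|b|,|c|) ≤ (6/5) α(2^𝔢 N_S) + 28`, and (second conjunct) every solution `(x, y) ∈ 𝒪 × 𝒪` of
`y² = x³ + a`, `0 ≠ a ∈ 𝒪`, has `max(h(x), (2/3)h(y)) ≤ Ω_opt(a, S)`. These are the bounds used in the algorithms
of §§3–4. Proof in print: as Props. 10.1/10.6 with Prop. 10.8 (i) (`log r_f ≤ α`) in place of (ii).
[cite: VonkanelMatschke2023, Prop. 10.7 (arXiv §10.5.1, prop:algobounds)] -/
def proposition_10_7 : Prop :=
  (∀ (S : Finset ℕ), (∀ p ∈ S, p.Prime) → ∀ a b c : ℤ, a ≠ 0 → b ≠ 0 → c ≠ 0 → a + b = c →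
    Int.gcd (Int.gcd a b : ℤ) c = 1 →
    UniqueFactorizationMonoid.radical (a * b * c).natAbs ∣ primesProd S →
      Real.log ((max |a| (max |b| |c|) : ℤ) : ℝ) ≤
        6 / 5 * vkmAlpha (refinedLevel (padicValNat 2 (a * b * c).natAbs) (primesProd S)) + 28) ∧
  (∀ (S : Finset ℕ), (∀ p ∈ S, p.Prime) → ∀ a : ℚ, a ≠ 0 → IsSInteger S a →
    ∀ x y : ℚ, IsSInteger S x → IsSInteger S y → y ^ 2 = x ^ 3 + a →
      max (logHeight₁ x) (2 / 3 * logHeight₁ y) ≤ omegaOpt S a)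

/-- **`Ω_opt ≤ Ω_sim`** (printed in §8.2: "It holds `Ω_opt ≤ Ω_sim = (1/3)h(k) + (4/9)k_S log k_S + (1/6)k_S
log log log k_S + (2/5)k_S`" and again in §9 for `(a, S)`), for every `0 ≠ a ∈ 𝒪`; in print it follows from
Prop. 10.8 (ii) (`α ≤ β ≤ (1/6)ν log N + …`, `ν(a_S) ≤ (2/3) a_S` by (10.x) `eq:nuineq`).
[cite: VonkanelMatschke2023, §8.2 and §9 (display Ω_opt ≤ Ω_sim)] -/
def omegaOpt_le_omegaSim : Prop :=
  ∀ (S : Finset ℕ), (∀ p ∈ S, p.Prime) → ∀ a : ℚ, a ≠ 0 → IsSInteger S a → omegaOpt S a ≤ omegaSim S a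

/-- The Mordell half of Prop. 10.7 together with `Ω_opt ≤ Ω_sim` gives back Prop. 10.1 (`mordell_height_le`)
— the printed relation between the optimized and the simplified bound, PROVED.
[cite: VonkanelMatschke2023, §10.1 ("simplified versions of our bounds")] -/
theorem mordell_height_le_of_proposition_10_7 (h : proposition_10_7) (hle : omegaOpt_le_omegaSim) :
    mordell_height_le := by
  intro S hS a ha haS x y hx hy hxy
  exact (h.2 S hS a ha haS x y hx hy hxy).trans (hle S hS a ha haS)

/-! ### Generalized Ramanujan–Nagell equations with `Ω_opt` (§9) -/

/-- **vKM Cor. 9.1** (`cor:ranabounds`; `b, c ∈ 𝒪` nonzero, `a = bc²`, `Ω_opt = Ω_opt(a, S)`): *"If `(x, y)`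
satisfies (1.5) [`x² + b = cy`, `(x, y) ∈ 𝒪 × 𝒪^×`] then `h(x²), h(y) ≤ 3 Ω_opt + 3 h(c) + 8 log N_S`."*
[cite: VonkanelMatschke2023, Cor. 9.1 (arXiv §9, cor:ranabounds)] -/
def corollary_9_1 : Prop :=
  ∀ (S : Finset ℕ), (∀ p ∈ S, p.Prime) → ∀ b c : ℚ, b ≠ 0 → c ≠ 0 → IsSInteger S b → IsSInteger S c →
    ∀ x y : ℚ, IsSInteger S x → IsSUnit S y → x ^ 2 + b = c * y →
      max (logHeight₁ (x ^ 2)) (logHeight₁ y) ≤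
        3 * omegaOpt S (b * c ^ 2) + 3 * logHeight₁ c + 8 * Real.log (primesProd S)

/-- **vKM Cor. 9.3** (`cor:sumsofunits`; `Ω = 3 Ω_opt(1, S) + 9 log N_S`): *"Assume that `u, v` are in `𝒪^×`.
(i) If `u + v` is a square in `ℚ`, then there is `ε ∈ 𝒪^×` such that `h(ε²u), h(ε²v) ≤ Ω`. (ii) If `u + v` is
a cube in `ℚ`, then there is `δ ∈ 𝒪^×` such that `h(δ³u), h(δ³v) ≤ Ω`."*
[cite: VonkanelMatschke2023, Cor. 9.3 (arXiv §9, cor:sumsofunits)] -/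
def corollary_9_3 : Prop :=
  ∀ (S : Finset ℕ), (∀ p ∈ S, p.Prime) → ∀ u v : ℚ, IsSUnit S u → IsSUnit S v →
    (IsSquare (u + v) → ∃ ε : ℚ, IsSUnit S ε ∧
        max (logHeight₁ (ε ^ 2 * u)) (logHeight₁ (ε ^ 2 * v)) ≤
          3 * omegaOpt S 1 + 9 * Real.log (primesProd S)) ∧
    ((∃ w : ℚ, u + v = w ^ 3) → ∃ δ : ℚ, IsSUnit S δ ∧
        max (logHeight₁ (δ ^ 3 * u)) (logHeight₁ (δ ^ 3 * v)) ≤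
          3 * omegaOpt S 1 + 9 * Real.log (primesProd S))

/-- Cor. 9.1 and `Ω_opt ≤ Ω_sim` give the simplified form `corollary_9_1_sim` of the sibling file (the printed
remark "`3 Ω_sim + 8 log N_S` is at most `2 a_S + h(a)`" then yields Corollary K), PROVED.
[cite: VonkanelMatschke2023, §9 (after Cor. 9.1)] -/
theorem corollary_9_1_sim_of (h : corollary_9_1) (hle : omegaOpt_le_omegaSim) : corollary_9_1_sim := by
  intro S hS b c hb hc hbS hcS x y hx hy hxy
  have h1 := h S hS b c hb hc hbS hcS x y hx hy hxy
  have ha : b * c ^ 2 ≠ 0 := mul_ne_zero hb (pow_ne_zero 2 hc)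
  have haS : IsSInteger S (b * c ^ 2) := by
    -- `𝒪` is a ring: the denominator of a product divides the product of the denominators
    have hsub : (b * c ^ 2).den.primeFactors ⊆ (b.den * (c ^ 2).den).primeFactors :=
      Nat.primeFactors_mono (Rat.mul_den_dvd b (c ^ 2)) (mul_ne_zero b.den_nz (c ^ 2).den_nz)
    have hc2 : (c ^ 2).den.primeFactors ⊆ S := by
      have : (c ^ 2).den = c.den ^ 2 := Rat.den_pow c 2
      rw [this, Nat.primeFactors_pow _ two_ne_zero]; exact hcS
    intro p hp
    have hp' := hsub hp
    rw [Nat.primeFactors_mul b.den_nz (c ^ 2).den_nz, Finset.mem_union] at hp'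
    exact hp'.elim (fun h => hbS h) (fun h => hc2 h)
  have h2 := hle S hS (b * c ^ 2) ha haS
  linarith

/-- Cor. 9.3 and `Ω_opt ≤ Ω_sim` give the simplified form `corollary_9_3_sim` of the sibling file, PROVED.
[cite: VonkanelMatschke2023, §9 (Ω with Ω_opt ≤ Ω_sim)] -/
theorem corollary_9_3_sim_of (h : corollary_9_3) (hle : omegaOpt_le_omegaSim) : corollary_9_3_sim := by
  intro S hS u v hu hv
  have h1 := h S hS u v hu hv
  have h2 := hle S hS 1 one_ne_zero (isSInteger_intCast S 1)
  refine ⟨fun hsq => ?_, fun hcu => ?_⟩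
  · obtain ⟨ε, hε, hb⟩ := h1.1 hsq
    exact ⟨ε, hε, by linarith⟩
  · obtain ⟨δ, hδ, hb⟩ := h1.2 hcu
    exact ⟨δ, hδ, by linarith⟩

/-! ### Cubic Thue and general Thue–Mahler equations with `Ω_opt` (§5 Def. 5.1, §8.2 Cor. 8.2, (8.x)) -/

/-- `h(f)` = the maximum of the logarithmic Weil heights of the coefficients of the cubic form `f` (§8.1:
"for any polynomial `g` with rational coefficients `a_α`, we define `h(g) = max_α h(a_α)`").
[cite: VonkanelMatschke2023, §8.1 (h(g))] -/
def formHeight (P : Cubic ℚ) : ℝ :=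
  max (max (logHeight₁ P.a) (logHeight₁ P.b)) (max (logHeight₁ P.c) (logHeight₁ P.d))

/-- **Definition 5.1** (`def:primsoltm`): `(x, y, z)` is a *primitive solution of the general cubic Thue–Mahler
equation* if `x, y, z ∈ ℤ` satisfy `f(x, y) = m z` with `z ∈ 𝒪^×` and `±1` are the only `d ∈ ℤ` with
`d ∣ gcd(x, y)` and `d³ ∣ z`. (Every solution of (1.4), where `gcd(x, y) = 1`, is primitive in this sense.)
[cite: VonkanelMatschke2023, Def. 5.1 (arXiv §5, def:primsoltm)] -/
def IsPrimitiveTMSolution (S : Finset ℕ) (P : Cubic ℚ) (m : ℚ) (x y z : ℤ) : Prop :=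
  IsSUnit S (z : ℚ) ∧ cubicFormEval P x y = m * z ∧
    ∀ d : ℤ, d ∣ x → d ∣ y → d ^ 3 ∣ z → d = 1 ∨ d = -1

/-- **vKM Cor. 8.2** (`cor:precthue`; `k = 432 Δ m²`, `Ω_opt = Ω_opt(k, S)`): *"Assume that `f, m ∈ ℤ[x, y]`.
(i) Suppose that `(x, y)` is a solution of the cubic Thue equation (1.3), and put `n = 1` if `(x, y) ∈ ℤ × ℤ`
and `n = 2` otherwise. Then `h(x)` and `h(y)` are at most `(n/2) Ω_opt + 6n (h(f − m) + 6h(f) + 186)`.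
(ii) Suppose that `(x, y, z)` is a primitive solution of the general cubic Thue–Mahler equation. Then `h(x)`,
`h(y)` and `(1/3)h(z)` are at most `2 Ω_opt + 51 log N_S + 24 (h(f − m) + 6h(f) + 186)`."* Standing hypotheses
(§5, §8): `S` a finite set of primes, `f` homogeneous cubic with nonzero discriminant, `m ≠ 0`; "(x, y) ∈ ℤ × ℤ"
is `x.den = 1 ∧ y.den = 1`. [cite: VonkanelMatschke2023, Cor. 8.2 (arXiv §8.2, cor:precthue)] -/
def corollary_8_2 : Prop :=
  ∀ (S : Finset ℕ), (∀ p ∈ S, p.Prime) → ∀ (P : Cubic ℚ) (m : ℚ), IsIntegralData P m → m ≠ 0 → P.discr ≠ 0 →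
    let k : ℚ := 432 * P.discr * m ^ 2
    (∀ x y : ℚ, IsSInteger S x → IsSInteger S y → cubicFormEval P x y = m →
        let n : ℝ := if x.den = 1 ∧ y.den = 1 then 1 else 2
        max (logHeight₁ x) (logHeight₁ y) ≤
          n / 2 * omegaOpt S k + 6 * n * (coeffHeight P m + 6 * formHeight P + 186)) ∧
    (∀ x y z : ℤ, IsPrimitiveTMSolution S P m x y z →
        max (max (logHeight₁ (x : ℚ)) (logHeight₁ (y : ℚ))) (1 / 3 * logHeight₁ (z : ℚ)) ≤
          2 * omegaOpt S k + 51 * Real.log (primesProd S) + 24 * (coeffHeight P m + 6 * formHeight P + 186))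

/-- **vKM (8.x) `eq:precthue`** (the general case `f ∈ 𝒪[x, y]`, `m ∈ 𝒪`): *"Statements (i) and (ii) of
Corollary 8.2 hold without the extra assumption `f, m ∈ ℤ[x, y]` if the bounds in (i) and (ii) are replaced by
`B₁ = Ω_opt + 86 (4h(f) + h(m) + 26)` and `2B₁ + 51 log N_S` respectively"* (`Ω_opt = Ω_opt(k, S)`, `k = 432 Δ m²`).
[cite: VonkanelMatschke2023, §8.2 display (eq:precthue)] -/
def eq_precthue : Prop :=
  ∀ (S : Finset ℕ), (∀ p ∈ S, p.Prime) → ∀ (P : Cubic ℚ) (m : ℚ), IsSIntegralData S P m → m ≠ 0 →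
    P.discr ≠ 0 →
    let k : ℚ := 432 * P.discr * m ^ 2
    let B₁ : ℝ := omegaOpt S k + 86 * (4 * formHeight P + logHeight₁ m + 26)
    (∀ x y : ℚ, IsSInteger S x → IsSInteger S y → cubicFormEval P x y = m →
        max (logHeight₁ x) (logHeight₁ y) ≤ B₁) ∧
    (∀ x y z : ℤ, IsPrimitiveTMSolution S P m x y z →
        max (max (logHeight₁ (x : ℚ)) (logHeight₁ (y : ℚ))) (1 / 3 * logHeight₁ (z : ℚ)) ≤
          2 * B₁ + 51 * Real.log (primesProd S))

/-- A solution of the Thue–Mahler equation (1.4) (`gcd(x, y) = 1`) is a primitive solution of the general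
equation in the sense of Definition 5.1 ("If `(x,y,z)` is a solution of the cubic Thue–Mahler equation discussed
in the introduction, then `(x,y,z)` is in particular a primitive solution"), PROVED.
[cite: VonkanelMatschke2023, §5 (remark after Def. 5.1)] -/
theorem isPrimitiveTMSolution_of_gcd_eq_one {S : Finset ℕ} {P : Cubic ℚ} {m : ℚ} {x y z : ℤ}
    (hz : IsSUnit S (z : ℚ)) (hgcd : Int.gcd x y = 1) (heq : cubicFormEval P x y = m * z) :
    IsPrimitiveTMSolution S P m x y z := by
  refine ⟨hz, heq, fun d hdx hdy _ => ?_⟩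
  have hd : d ∣ (Int.gcd x y : ℤ) := Int.dvd_coe_gcd hdx hdy
  rw [hgcd] at hd
  exact (Int.isUnit_iff.mp (isUnit_of_dvd_one (by exact_mod_cast hd)))

end VonKanelMatschke

end Literature.NumberTheory.DiophantineGeometry

end
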